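import Mathlib
import Literature.NumberTheory.Transcendental.KZSemialgebraicComplex
import Literature.NumberTheory.Transcendental.SemialgebraicMapsProofs
import Summits.KontsevichZagierPeriods.KontsevichZagierPeriods.Theorems.SoloInformedKZCubeGrid
import HarnessLib

/-!
# SoloInformed — boundedness inside the KZ calculus

**THEOREM B** (step P1 of `SoloInformedAyoubCubeResolution`): every integral representation `r`
(`ℚ`-semialgebraic, possibly unbounded domain `D ⊆ ℝⁿ`, absolutely integrable `ℚ`-semialgebraic
integrand) is equivalent under the Kontsevich–Zagier moves, with multiplicity one, to the sum of
`3ⁿ` representations with domains in `[-1, 1]ⁿ` (`soloInformed_kzBounded`): split `ℝ` into the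
strips `[-1,1]`, `[1,∞)`, `(-∞,-1]` and `D` into the pieces `D ∩ {x | xᵢ ∈ strip (σ i)}` (rule (1),
overlaps in the hyperplanes `xᵢ = ±1`), then invert the unbounded coordinates, `Φ_σ : xᵢ ↦ xᵢ⁻¹`
(rule (2): rational, injective, `C¹`, Jacobian `∏ (−xᵢ⁻²)`); the new integrand
`y ↦ f (Φ_σ y) · ∏ yᵢ⁻²` is `ℚ`-semialgebraic (Tarski–Seidenberg) and integrable (Jacobian formula).
References: Kontsevich–Zagier 2001, §1.2 rules (1)–(2); Bochnak–Coste–Roy 1998, Prop. 2.2.6–7.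
-/

noncomputable section

open scoped BigOperators
open MeasureTheory Set MvPolynomial
open Literature.NumberTheory.Transcendental Literature.NumberTheory.Transcendental.KZ
open Literature.ModelTheory.ExponentialFields (IsSemialgebraic isSemialgebraic_setOf_eval_le)

namespace Summit.KontsevichZagierPeriods.KontsevichZagierPeriods.Theorems

variable {n : ℕ}

/-! ### Strips and sign regions -/

/-- The three closed strips of `ℝ`: `0 ↦ [-1, 1]`, `1 ↦ [1, ∞)`, `2 ↦ (-∞, -1]`. -/
def soloInformedStrip (a : Fin 3) : Set ℝ :=
  if a = 0 then Icc (-1) 1 else if a = 1 then Ici 1 else Iic (-1)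

/-- Every real number lies in one of the three strips. -/
theorem soloInformed_exists_mem_strip (t : ℝ) : ∃ a, t ∈ soloInformedStrip a := by
  by_cases h1 : 1 ≤ t
  · exact ⟨1, by simp [soloInformedStrip, h1]⟩
  by_cases h2 : t ≤ -1
  · exact ⟨2, by simp [soloInformedStrip, h2]⟩
  · exact ⟨0, by simp only [soloInformedStrip, if_true, mem_Icc]; constructor <;> linarith⟩

/-- Membership in a strip, by cases. -/
theorem soloInformed_mem_strip_iff (a : Fin 3) (t : ℝ) : t ∈ soloInformedStrip a ↔
    (a = 0 ∧ -1 ≤ t ∧ t ≤ 1) ∨ (a = 1 ∧ 1 ≤ t) ∨ (a ≠ 0 ∧ a ≠ 1 ∧ t ≤ -1) := by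
  unfold soloInformedStrip
  split_ifs with h0 h1
  · simp [h0]
  · simp [h1]
  · simp [h0, h1]

/-- Points of the two unbounded strips have absolute value at least one. -/
theorem soloInformed_one_le_abs_of_mem_strip {a : Fin 3} (ha : a ≠ 0) {t : ℝ}
    (ht : t ∈ soloInformedStrip a) : 1 ≤ |t| := by
  rw [soloInformed_mem_strip_iff] at ht
  rcases ht with ⟨h, -⟩ | ⟨-, h⟩ | ⟨-, -, h⟩
  · exact absurd h ha
  · exact h.trans (le_abs_self t)
  · exact (by linarith : 1 ≤ -t).trans (neg_le_abs t)

/-- The inverse of a point of an unbounded strip lies in `[-1, 1]` (and the point is non-zero). -/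
theorem soloInformed_inv_mem_Icc_of_mem_strip {a : Fin 3} (ha : a ≠ 0) {t : ℝ}
    (ht : t ∈ soloInformedStrip a) : (-1 ≤ t⁻¹ ∧ t⁻¹ ≤ 1) ∧ t ≠ 0 := by
  have h := soloInformed_one_le_abs_of_mem_strip ha ht
  refine ⟨abs_le.1 ?_, fun h0 => by norm_num [h0] at h⟩
  rw [abs_inv]
  exact inv_le_one_of_one_le₀ h

/-- Two distinct strips meet inside `{1, -1}`. -/
theorem soloInformed_mem_strip_inter {a b : Fin 3} (hab : a ≠ b) {t : ℝ}
    (ha : t ∈ soloInformedStrip a) (hb : t ∈ soloInformedStrip b) : t = 1 ∨ t = -1 := by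
  rw [soloInformed_mem_strip_iff] at ha hb
  rcases ha with ⟨rfl, h1, h2⟩ | ⟨rfl, h1⟩ | ⟨ha0, ha1, h1⟩ <;>
    rcases hb with ⟨rfl, h3, h4⟩ | ⟨rfl, h3⟩ | ⟨hb0, hb1, h3⟩
  all_goals first
    | exact absurd rfl hab
    | (left; linarith)
    | (right; linarith)
    | exact (hab (by omega)).elim

/-- The sign region of `σ : Fin n → Fin 3`: the points whose `i`-th coordinate lies in the strip
`σ i`. -/
def soloInformedRegion (σ : Fin n → Fin 3) : Set (Fin n → ℝ) :=
  {x | ∀ i, x i ∈ soloInformedStrip (σ i)}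

/-- The set of points whose `i`-th coordinate lies in a given strip is `ℚ`-semialgebraic. -/
theorem soloInformed_isSemialgebraic_coord_mem_strip (i : Fin n) (a : Fin 3) :
    IsSemialgebraic ℚ {x : Fin n → ℝ | x i ∈ soloInformedStrip a} := by
  have hle : ∀ p q : MvPolynomial (Fin n) ℚ,
      IsSemialgebraic ℚ {x : Fin n → ℝ | aeval x p ≤ aeval x q} :=
    fun p q => isSemialgebraic_setOf_eval_le p q
  by_cases ha0 : a = 0
  · convert (hle (C (-1)) (X i)).inter (hle (X i) (C 1)) using 1
    ext x
    simp [soloInformedStrip, ha0]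
  by_cases ha1 : a = 1
  · convert hle (C 1) (X i) using 1
    ext x
    simp [soloInformedStrip, ha1]
  · convert hle (X i) (C (-1)) using 1
    ext x
    simp [soloInformedStrip, ha0, ha1]

/-- Sign regions are `ℚ`-semialgebraic. -/
theorem isSemialgebraic_soloInformedRegion (σ : Fin n → Fin 3) :
    IsSemialgebraic ℚ (soloInformedRegion σ) := by
  have h : soloInformedRegion σ = ⋂ i ∈ (Finset.univ : Finset (Fin n)),
      {x : Fin n → ℝ | x i ∈ soloInformedStrip (σ i)} := by
    ext x
    simp [soloInformedRegion]
  rw [h]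
  exact IsSemialgebraic.biInter _ _ fun i _ => soloInformed_isSemialgebraic_coord_mem_strip i (σ i)

/-- The sign regions cover `ℝⁿ`. -/
theorem soloInformed_iUnion_region : (⋃ σ : Fin n → Fin 3, soloInformedRegion σ) = univ := by
  refine eq_univ_of_forall fun x => ?_
  choose σ hσ using fun i => soloInformed_exists_mem_strip (x i)
  exact mem_iUnion.2 ⟨σ, hσ⟩

/-- Distinct sign regions overlap in a Lebesgue-null set (two coordinate hyperplanes). -/
theorem soloInformed_volume_region_inter {σ τ : Fin n → Fin 3} (h : σ ≠ τ) :
    volume (soloInformedRegion σ ∩ soloInformedRegion τ) = 0 := by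
  obtain ⟨i, hi⟩ := Function.ne_iff.1 h
  have hsub : soloInformedRegion σ ∩ soloInformedRegion τ ⊆
      {x : Fin n → ℝ | x i = 1} ∪ {x : Fin n → ℝ | x i = -1} := by
    rintro x ⟨hx, hx'⟩
    exact soloInformed_mem_strip_inter hi (hx i) (hx' i)
  refine measure_mono_null hsub (measure_union_null ?_ ?_)
  · exact Measure.pi_hyperplane (fun _ : Fin n => (volume : Measure ℝ)) i _
  · exact Measure.pi_hyperplane (fun _ : Fin n => (volume : Measure ℝ)) i _

/-! ### The coordinate inversion `Φ_σ` -/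

/-- `Φ_σ x = (xᵢ if σ i = 0, else xᵢ⁻¹)ᵢ`. -/
def soloInformedInvMap (σ : Fin n → Fin 3) (x : Fin n → ℝ) : Fin n → ℝ :=
  fun i => if σ i = 0 then x i else (x i)⁻¹

/-- `Φ_σ` is an involution. -/
theorem soloInformedInvMap_invMap (σ : Fin n → Fin 3) (x : Fin n → ℝ) :
    soloInformedInvMap σ (soloInformedInvMap σ x) = x := by
  funext i
  by_cases h : σ i = 0 <;> simp [soloInformedInvMap, h]

/-- `Φ_σ` is injective. -/
theorem soloInformedInvMap_injective (σ : Fin n → Fin 3) :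
    Function.Injective (soloInformedInvMap σ) :=
  Function.LeftInverse.injective (soloInformedInvMap_invMap σ)

/-- `Φ_σ` maps the sign region `σ` into the cube `[-1, 1]ⁿ`. -/
theorem soloInformed_invMap_mem_Icc {σ : Fin n → Fin 3} {x : Fin n → ℝ}
    (hx : x ∈ soloInformedRegion σ) (i : Fin n) :
    -1 ≤ soloInformedInvMap σ x i ∧ soloInformedInvMap σ x i ≤ 1 := by
  by_cases h : σ i = 0
  · have hxi := hx i
    simp only [h, soloInformedStrip, if_true, mem_Icc] at hxi
    simpa [soloInformedInvMap, h] using hxi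
  · simpa [soloInformedInvMap, h] using (soloInformed_inv_mem_Icc_of_mem_strip h (hx i)).1

/-- The Jacobian factors `aᵢ(x) = 1` (bounded coordinates) or `xᵢ⁻²` (inverted ones). -/
def soloInformedJacFactor (σ : Fin n → Fin 3) (x : Fin n → ℝ) (i : Fin n) : ℝ :=
  if σ i = 0 then 1 else ((x i) ^ 2)⁻¹

/-- The derivative of `Φ_σ`: the diagonal map with entries `1` or `−xᵢ⁻²`. -/
def soloInformedInvDeriv (σ : Fin n → Fin 3) (x : Fin n → ℝ) :
    (Fin n → ℝ) →L[ℝ] (Fin n → ℝ) :=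
  ContinuousLinearMap.pi fun i =>
    (if σ i = 0 then (1 : ℝ) else -((x i) ^ 2)⁻¹) • ContinuousLinearMap.proj i

/-- `Φ_σ` has derivative `soloInformedInvDeriv σ x` wherever the inverted coordinates are
non-zero. -/
theorem soloInformed_hasFDerivAt_invMap (σ : Fin n → Fin 3) {x : Fin n → ℝ}
    (hx : ∀ i, σ i ≠ 0 → x i ≠ 0) :
    HasFDerivAt (soloInformedInvMap σ) (soloInformedInvDeriv σ x) x := by
  show HasFDerivAt (fun (y : Fin n → ℝ) (i : Fin n) => if σ i = 0 then y i else (y i)⁻¹)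
    (ContinuousLinearMap.pi fun i =>
      (if σ i = 0 then (1 : ℝ) else -((x i) ^ 2)⁻¹) • ContinuousLinearMap.proj i) x
  refine hasFDerivAt_pi.2 fun i => ?_
  by_cases h : σ i = 0
  · simp only [h, if_true, one_smul]
    exact hasFDerivAt_apply (𝕜 := ℝ) i x
  · simp only [h, if_false]
    have h1 : HasFDerivAt (𝕜 := ℝ) (fun y : Fin n → ℝ => y i)
        (ContinuousLinearMap.proj (R := ℝ) i) x :=
      hasFDerivAt_apply (𝕜 := ℝ) i x
    have h2 : HasDerivAt (fun t : ℝ => t⁻¹) (-((x i) ^ 2)⁻¹) (x i) := hasDerivAt_inv (hx i h)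
    have := h2.comp_hasFDerivAt x h1
    simpa only [Function.comp_def] using this

/-- `det Φ_σ'(x) = ∏ᵢ (1 or −xᵢ⁻²)`. -/
theorem soloInformed_det_invDeriv (σ : Fin n → Fin 3) (x : Fin n → ℝ) :
    (soloInformedInvDeriv σ x).det = ∏ i, (if σ i = 0 then (1 : ℝ) else -((x i) ^ 2)⁻¹) := by
  have h : ((soloInformedInvDeriv σ x : (Fin n → ℝ) →L[ℝ] (Fin n → ℝ)) :
      (Fin n → ℝ) →ₗ[ℝ] (Fin n → ℝ)) =
      Matrix.toLin' (Matrix.diagonal fun i => if σ i = 0 then (1 : ℝ) else -((x i) ^ 2)⁻¹) := by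
    apply LinearMap.ext fun v => ?_
    funext i
    by_cases h : σ i = 0 <;> simp [soloInformedInvDeriv, Matrix.mulVec_diagonal, h]
  rw [ContinuousLinearMap.det, h, LinearMap.det_toLin', Matrix.det_diagonal]

/-- `|det Φ_σ'(x)| = ∏ᵢ aᵢ(x)`. -/
theorem soloInformed_abs_det_invDeriv (σ : Fin n → Fin 3) (x : Fin n → ℝ) :
    |(soloInformedInvDeriv σ x).det| = ∏ i, soloInformedJacFactor σ x i := by
  rw [soloInformed_det_invDeriv, Finset.abs_prod]
  refine Finset.prod_congr rfl fun i _ => ?_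
  by_cases h : σ i = 0
  · simp [soloInformedJacFactor, h]
  · simp only [soloInformedJacFactor, h, if_false, abs_neg]
    exact abs_of_nonneg (by positivity)

/-- The Jacobian polynomial `P_σ = ∏_{σ i ≠ 0} Xᵢ²`. -/
def soloInformedJacPoly (σ : Fin n → Fin 3) : MvPolynomial (Fin n) ℚ :=
  ∏ i, if σ i = 0 then 1 else X i ^ 2

/-- `P_σ(y) = ∏_{σ i ≠ 0} yᵢ²`. -/
theorem soloInformed_aeval_jacPoly (σ : Fin n → Fin 3) (y : Fin n → ℝ) :
    aeval y (soloInformedJacPoly σ) = ∏ i, (if σ i = 0 then (1 : ℝ) else (y i) ^ 2) := by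
  rw [soloInformedJacPoly, map_prod]
  refine Finset.prod_congr rfl fun i _ => ?_
  by_cases h : σ i = 0 <;> simp [h]

/-- `P_σ(Φ_σ x) = ∏ᵢ aᵢ(x)`. -/
theorem soloInformed_aeval_jacPoly_invMap (σ : Fin n → Fin 3) (x : Fin n → ℝ) :
    aeval (soloInformedInvMap σ x) (soloInformedJacPoly σ) = ∏ i, soloInformedJacFactor σ x i := by
  rw [soloInformed_aeval_jacPoly]
  refine Finset.prod_congr rfl fun i _ => ?_
  by_cases h : σ i = 0 <;> simp [soloInformedJacFactor, soloInformedInvMap, h, inv_pow]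

/-- The Jacobian factor product is non-zero when the inverted coordinates are. -/
theorem soloInformed_prod_jacFactor_ne_zero (σ : Fin n → Fin 3) {x : Fin n → ℝ}
    (hx : ∀ i, σ i ≠ 0 → x i ≠ 0) : ∏ i, soloInformedJacFactor σ x i ≠ 0 := by
  refine Finset.prod_ne_zero_iff.2 fun i _ => ?_
  by_cases h : σ i = 0
  · simp [soloInformedJacFactor, h]
  · simp only [soloInformedJacFactor, h, if_false]
    exact inv_ne_zero (pow_ne_zero 2 (hx i h))

/-- **The change-of-variables identity**: `f x = (f (Φ (Φ x)) · P_σ(Φ x)⁻¹) · |det Φ'(x)|`. -/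
theorem soloInformed_invMap_identity (σ : Fin n → Fin 3) (f : (Fin n → ℝ) → ℝ) {x : Fin n → ℝ}
    (hx : ∀ i, σ i ≠ 0 → x i ≠ 0) :
    f x = f (soloInformedInvMap σ (soloInformedInvMap σ x)) *
      (aeval (soloInformedInvMap σ x) (soloInformedJacPoly σ))⁻¹ *
        |(soloInformedInvDeriv σ x).det| := by
  rw [soloInformedInvMap_invMap, soloInformed_aeval_jacPoly_invMap, soloInformed_abs_det_invDeriv,
    mul_assoc, inv_mul_cancel₀ (soloInformed_prod_jacFactor_ne_zero σ hx), mul_one]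

/-- `Φ_σ` is a `ℚ`-semialgebraic map on any `ℚ`-semialgebraic set avoiding the zeros of the
inverted coordinates. [BCR 1998, Prop. 2.2.6] -/
theorem soloInformed_isSemialgebraicMapOn_invMap (σ : Fin n → Fin 3) {S : Set (Fin n → ℝ)}
    (hS : IsSemialgebraic ℚ S) (h0 : ∀ x ∈ S, ∀ i, σ i ≠ 0 → x i ≠ 0) :
    IsSemialgebraicMapOn ℚ S (soloInformedInvMap σ) := by
  refine IsSemialgebraicMapOn.of_forall hS fun i => ?_
  have hX : IsSemialgebraicFunOn ℚ S (fun x : Fin n → ℝ => x i) :=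
    (isSemialgebraicFunOn_aeval hS (X i)).congr fun x _ => by simp
  by_cases h : σ i = 0
  · exact hX.congr fun x _ => by simp [soloInformedInvMap, h]
  · exact (hX.inv fun x hx => h0 x hx i h).congr fun x _ => by simp [soloInformedInvMap, h]

/-! ### The bounded pieces -/

/-- In the region `σ` (intersected with anything) the inverted coordinates do not vanish. -/
theorem soloInformed_ne_zero_of_mem_region {σ : Fin n → Fin 3} {x : Fin n → ℝ}
    (hx : x ∈ soloInformedRegion σ) (i : Fin n) (hi : σ i ≠ 0) : x i ≠ 0 :=
  (soloInformed_inv_mem_Icc_of_mem_strip hi (hx i)).2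

/-- On the image `Φ_σ (D ∩ region σ)` the inverted coordinates do not vanish either. -/
theorem soloInformed_ne_zero_of_mem_image {σ : Fin n → Fin 3} {D : Set (Fin n → ℝ)}
    {y : Fin n → ℝ} (hy : y ∈ soloInformedInvMap σ '' (D ∩ soloInformedRegion σ)) (i : Fin n)
    (hi : σ i ≠ 0) : y i ≠ 0 := by
  obtain ⟨x, hx, rfl⟩ := hy
  simp only [soloInformedInvMap, hi, if_false]
  exact inv_ne_zero (soloInformed_ne_zero_of_mem_region hx.2 i hi)

/-- The piece `D ∩ region σ` is `ℚ`-semialgebraic. -/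
theorem soloInformed_isSemialgebraic_piece (r : IntegralRep n) (σ : Fin n → Fin 3) :
    IsSemialgebraic ℚ (r.domain ∩ soloInformedRegion σ) :=
  r.isSemialgebraic_domain.inter (isSemialgebraic_soloInformedRegion σ)

/-- Its image under `Φ_σ` is `ℚ`-semialgebraic (Tarski–Seidenberg). [BCR 1998, Prop. 2.2.7] -/
theorem soloInformed_isSemialgebraic_image_piece (r : IntegralRep n) (σ : Fin n → Fin 3) :
    IsSemialgebraic ℚ (soloInformedInvMap σ '' (r.domain ∩ soloInformedRegion σ)) :=
  IsSemialgebraicMapOn.isSemialgebraic_image_holds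
    (soloInformed_isSemialgebraicMapOn_invMap σ (soloInformed_isSemialgebraic_piece r σ)
      fun _ hx i hi => soloInformed_ne_zero_of_mem_region hx.2 i hi)
    Subset.rfl (soloInformed_isSemialgebraic_piece r σ)

/-- **The bounded piece `r_σ`**: domain `Φ_σ (D ∩ region σ) ⊆ [-1,1]ⁿ`, integrand
`y ↦ f (Φ_σ y) · P_σ(y)⁻¹`. Semialgebraicity by Tarski–Seidenberg (image, composition, product,
inverse), integrability by the change-of-variables theorem. [BCR 1998, Prop. 2.2.6–2.2.7] -/
def soloInformedInvRep (r : IntegralRep n) (σ : Fin n → Fin 3) : IntegralRep n where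
  domain := soloInformedInvMap σ '' (r.domain ∩ soloInformedRegion σ)
  integrand y := r.integrand (soloInformedInvMap σ y) * (aeval y (soloInformedJacPoly σ))⁻¹
  isSemialgebraic_domain := soloInformed_isSemialgebraic_image_piece r σ
  isSemialgebraicFunOn_integrand := by
    have hS := soloInformed_isSemialgebraic_image_piece r σ
    have hΦ : IsSemialgebraicMapOn ℚ (soloInformedInvMap σ '' (r.domain ∩ soloInformedRegion σ))
        (soloInformedInvMap σ) :=
      soloInformed_isSemialgebraicMapOn_invMap σ hS fun _ hy i hi =>
        soloInformed_ne_zero_of_mem_image hy i hi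
    have hmaps : MapsTo (soloInformedInvMap σ)
        (soloInformedInvMap σ '' (r.domain ∩ soloInformedRegion σ)) r.domain := by
      rintro _ ⟨x, hx, rfl⟩
      rw [soloInformedInvMap_invMap]
      exact hx.1
    have hcomp := IsSemialgebraicFunOn.comp_isSemialgebraicMapOn_holds
      r.isSemialgebraicFunOn_integrand hΦ hmaps
    have hinv := (isSemialgebraicFunOn_aeval hS (soloInformedJacPoly σ)).inv fun y hy => by
      rw [soloInformed_aeval_jacPoly]
      refine Finset.prod_ne_zero_iff.2 fun i _ => ?_
      by_cases h : σ i = 0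
      · simp [h]
      · simp only [h, if_false]
        exact pow_ne_zero 2 (soloInformed_ne_zero_of_mem_image hy i h)
    exact IsSemialgebraicFunOn.mul_holds hcomp hinv
  integrableOn := by
    have hDm : MeasurableSet (r.domain ∩ soloInformedRegion σ) :=
      IsSemialgebraic.measurableSet_holds (soloInformed_isSemialgebraic_piece r σ)
    rw [integrableOn_image_iff_integrableOn_abs_det_fderiv_smul volume hDm
      (fun x hx => (soloInformed_hasFDerivAt_invMap σ
        (fun i hi => soloInformed_ne_zero_of_mem_region hx.2 i hi)).hasFDerivWithinAt)
      (soloInformedInvMap_injective σ).injOn]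
    refine (r.integrableOn.mono_set inter_subset_left).congr_fun (fun x hx => ?_) hDm
    rw [smul_eq_mul, mul_comm]
    exact soloInformed_invMap_identity σ r.integrand
      fun i hi => soloInformed_ne_zero_of_mem_region hx.2 i hi

/-- The domain of a bounded piece lies in the cube `[-1, 1]ⁿ`. -/
theorem soloInformed_invRep_domain_subset (r : IntegralRep n) (σ : Fin n → Fin 3) :
    (soloInformedInvRep r σ).domain ⊆ {y : Fin n → ℝ | ∀ i, -1 ≤ y i ∧ y i ≤ 1} := by
  rintro _ ⟨x, hx, rfl⟩ i
  exact soloInformed_invMap_mem_Icc hx.2 i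

/-- **THEOREM B, indexed form**: `[r] − ∑_σ [r_σ] ∈ KZ.relations`. Finite domain additivity over
the sign regions, then one change of variables `Φ_σ` per region.
[Kontsevich–Zagier 2001, §1.2 rules (1), (2)] -/
theorem soloInformed_of_sub_sum_invRep_mem_relations (r : IntegralRep n) :
    of r - ∑ σ : Fin n → Fin 3, of (soloInformedInvRep r σ) ∈ relations := by
  classical
  have hD := soloInformed_isSemialgebraic_piece r
  set p : (Fin n → Fin 3) → IntegralRep n := fun σ =>
    r.restrict (r.domain ∩ soloInformedRegion σ) (hD σ) inter_subset_left with hp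
  -- rule (1)
  have hadd : of r - ∑ σ, of (p σ) ∈ relations :=
    soloInformed_of_sub_sum_mem_relations_of_iUnion (fun σ => r.domain ∩ soloInformedRegion σ)
      hD (fun σ τ h => measure_mono_null
        (inter_subset_inter inter_subset_right inter_subset_right)
        (soloInformed_volume_region_inter h))
      p (fun _ => rfl) r (by rw [← inter_iUnion, soloInformed_iUnion_region, inter_univ])
      fun _ _ _ => rfl
  -- rule (2)
  have hcov : ∀ σ, of (p σ) - of (soloInformedInvRep r σ) ∈ relations := fun σ => by
    refine changeOfVariablesRel_subset_relations ⟨n, p σ, soloInformedInvRep r σ,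
      soloInformedInvMap σ, soloInformedInvDeriv σ, ?_, ?_, ?_, rfl, ?_, rfl⟩
    · exact soloInformed_isSemialgebraicMapOn_invMap σ (hD σ)
        fun _ hx i hi => soloInformed_ne_zero_of_mem_region hx.2 i hi
    · exact fun x hx => (soloInformed_hasFDerivAt_invMap σ
        fun i hi => soloInformed_ne_zero_of_mem_region hx.2 i hi).hasFDerivWithinAt
    · exact (soloInformedInvMap_injective σ).injOn
    · intro x hx
      exact soloInformed_invMap_identity σ r.integrand
        fun i hi => soloInformed_ne_zero_of_mem_region hx.2 i hi
  have heq : of r - ∑ σ, of (soloInformedInvRep r σ) =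
      (of r - ∑ σ, of (p σ)) - ∑ σ, (of (soloInformedInvRep r σ) - of (p σ)) := by
    rw [Finset.sum_sub_distrib]
    abel
  rw [heq]
  refine relations.sub_mem hadd (relations.sum_mem fun σ _ => ?_)
  have := relations.neg_mem (hcov σ)
  rwa [neg_sub] at this

/-- **THEOREM B (boundedness inside the KZ calculus).** Every integral representation is
equivalent under the moves, with multiplicity one, to a sum of finitely many (`3ⁿ`)
representations with domains inside the cube `[-1, 1]ⁿ`.
[Kontsevich–Zagier 2001, §1.2 rules (1), (2)] -/
theorem soloInformed_kzBounded (r : IntegralRep n) :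
    ∃ (m : ℕ) (rs : Fin m → IntegralRep n),
      (∀ k, (rs k).domain ⊆ {y : Fin n → ℝ | ∀ i, -1 ≤ y i ∧ y i ≤ 1}) ∧
      of r - ∑ k, of (rs k) ∈ relations := by
  refine ⟨3 ^ n, fun k => soloInformedInvRep r (finFunctionFinEquiv.symm k),
    fun k => soloInformed_invRep_domain_subset r _, ?_⟩
  rw [Equiv.sum_comp finFunctionFinEquiv.symm (fun σ => of (soloInformedInvRep r σ))]
  exact soloInformed_of_sub_sum_invRep_mem_relations r

end Summit.KontsevichZagierPeriods.KontsevichZagierPeriods.Theorems
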